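import Summits.QuantumFields.BalabanUV.Beta.SymMixedReflectionLetterAn1
import Summits.QuantumFields.BalabanUV.Beta.SecondOrderBorderClassKit
import Summits.QuantumFields.BalabanUV.Beta.SymSecondOrderSplitLoc
import Summits.QuantumFields.BalabanUV.Beta.DiagonalContactLoc
import Summits.QuantumFields.BalabanUV.Beta.SymSecondOrderClassStep

/-!
# `BalabanUV.Beta.SymMixedRemainderClass` — binder row D1, hR side of the (0.4) ROOT: **an1's explicit mixed reflection remainder `symRMrAn1`
# IS A `LocStencilFM` FAMILY** at some positive rate, every level `j`, axis `α`, every `γ`, `cΛ`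
# (β sub-cell, D1 formalisation swarm, unit `b2b-balaban-beta-d1-formalise-leaf-03`, gen 17; a supplier class for the Δ-half of the class step,
# the row-D1 OWNER an2's GO R-D1-g33-0 «… the mixed remainder's `LocStencilFM` class of `symRMrAn1` …», journal l.35557)

NOT IN PRINT; OUR BOOKKEEPING.  HONEST FRAMING (cell contract, verbatim): «discharging `BetaPertH` makes Bałaban's UV stability
UNCONDITIONAL — a real constructive-QFT result; it is NOT the continuum limit and NOT the Clay problem.»  HONEST DEPENDENCY (verbatim):
«continuum YM on T⁴ ⇐ BetaPertH ∧ nine spine estimates (0/9 proved); BetaPertH ⇐ (D1) ∧ (D4) ∧ CAP+tail; G-an2-4 gates asym, D1 and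
NE2/3/4.»  [folklore] exponential-localisation bookkeeping over OUR objects; instantiates NO binder of the β-function wall; no `[cite:]`, no `def`,
no `def … : Prop`; NOT D1, NOT `BetaPertH`, NOT continuum, NOT Clay.

## What

`SymMixedReflectionLetterAn1.symRMrAn1 Lc cΛ γ j α κ u ρ w = wM2 • (2 • diagK (ctGen κ u) ∘ H ρ w + (2·[ρ = α]·q¹_sym_{ρw}(κ,u)) • H ρ w) − conjV (M1 ρ w) (diagK (γ_j·E_{κu}))`
with `H = symHessFFAt ρ_c Lc` (a vertex family: each `H ρ w` bi-localised at the coarse point `Lc•w`), `M1 = M1Of 3 Lc H cΛ j` (a vertex family),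
the comb generator `diagK (ctGen κ u)` and the border-reading generator `diagK (γ_j·E_{κu})` (both bi-localised at the fine bond `u`), and the
scalar `q¹_sym_{ρw}(κ,u) = symLinKerAt ρ_c Lc ρ w (κ, u)`, which VANISHES unless `u` lies in the support box of `w` (`symLinKerAt_eq_zero`) and is
bounded by `ell` there (`abs_symLinKerAt_le`).  Hence every summand is bi-localised at `(u, u)` with a constant decaying in `|u − Lc•w|₁` — the class
`SecondOrderResponse.LocStencilFM Lc` that `W2OfK`'s mixed slot asks of a remainder (leaf-05's `sep_mixOfK`, leaf-10 ∕ an2's `W2OfK_add_slot₂`).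
* §1 `biLoc_smul_near` — a kernel bi-localised at the coarse point, scaled by a scalar supported on the box of that point, is bi-localised at the
  fine bond with the `LocStencilFM` decay factor.
* §2 **`locStencilFM_symRMrAn1 (cΛ γ j α) : ∃ C δ, 0 < δ ∧ LocStencilFM Lc (symRMrAn1 Lc cΛ γ j α) C δ`** (an2's `biLoc_comp_far_left ∕ _right` for the
  two products and the commutator; §1 for the scalar term).
Provenance: β sub-cell, unit `b2b-balaban-beta-d1-formalise-leaf-03` gen 17, 2026-08-21 (v1); no existing file touched.
-/

noncomputable section

open Finset
open scoped BigOperators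
open Literature.MathematicalPhysics.QuantumFieldTheory
open Literature.MathematicalPhysics.QuantumFieldTheory.Balaban1983to89
open Literature.MathematicalPhysics.QuantumFieldTheory.Balaban1983to89.Beta
open B12Sec2to5 (l1 l1_nonneg)
open ExpKernelCalculus (MKer Decays BiLoc VertexFamily comp Zl Zl_pos l1_sub_symm)
open KernelWard (biLoc_add biLoc_sub biLoc_recentre)
open StepJetData (biLoc_weaken biLoc_smul)
open AffineAveraging (box toSite)
open AveragingContoursRooted (ctr ctrOff ctrOff_mem_box)
open AveragingHessianKernels (Near near_self l1_le_of_near)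
open OneStepResolventKernel (Fib LocStencil biLoc_mono)
open SecondOrderResponse (LocStencilFM)
open BalabanStepW2 (wM2)
open Summit.QuantumFields.BalabanUV.Beta.TameKernelCalculus
open Summit.QuantumFields.BalabanUV.Beta.ChartConjugation (conjV)
open Summit.QuantumFields.BalabanUV.Beta.AxialDressingRooted (one_le_of_neZero)
open Summit.QuantumFields.BalabanUV.Beta.BorderedHessian (bhK diagK ctGen cCT cCT_nonneg biLoc_diagK_ctGen spr_bhK)
open Summit.QuantumFields.BalabanUV.Beta.SecondOrderBorderClassKit (biLoc_comp_far_left biLoc_comp_far_right biLoc_add' biLoc_sub')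
open Summit.QuantumFields.BalabanUV.Beta.SpineRooted (M1Of vertexFamily_M1Of)
open Summit.QuantumFields.BalabanUV.Beta.RelInvNullShift (spr_add)
open Summit.QuantumFields.BalabanUV.Beta.DshAn1 (Dsh spr_Dsh)
open Summit.QuantumFields.BalabanUV.Beta.E3ContactGenerator (ctGenM)
open Summit.QuantumFields.BalabanUV.Beta.SymAveragingHessianCounts (symHessFFAt symLinKerAt symLinKerAt_eq_zero abs_symLinKerAt_le vertexFamily_symHessFFAt)
open Summit.QuantumFields.BalabanUV.Beta.SymSecondOrderSplitLoc (locStencil_diagK_mul_ctGenM)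
open Summit.QuantumFields.BalabanUV.Beta.SymSecondOrderClassStep (pkg_of_spr)
open Summit.QuantumFields.BalabanUV.Beta.SymMixedReflectionLetterAn1 (symRMrAn1)

namespace Summit.QuantumFields.BalabanUV.Beta.SymMixedRemainderClass

variable {d : ℕ}

/-! ## §1 A coarse-localised kernel scaled by a box-supported scalar -/

/-- [folklore] **BOX-SUPPORTED SCALAR × COARSE-LOCALISED KERNEL**: if `H` is bi-localised at `(N•w, N•w)` with constant `CH` (rate `δ ≥ 0`) and the
scalar `c` vanishes unless `u` lies in the support box of `w` (`Near N w u`), where `|c| ≤ B`, then `c • H` is bi-localised at `(u, u)` with constant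
`B·CH·e^{6δ(d+1)N}·e^{−δ|u − N•w|₁}` (two points of one box are `2(d+1)N`-close: `l1_le_of_near`). -/
theorem biLoc_smul_near {N : ℕ} (hN : 1 ≤ N) {H : MKer (d + 1) (Fib d)} {w u : Fin (d + 1) → ℤ} {CH δ : ℝ} (hH : BiLoc H ((N : ℤ) • w) ((N : ℤ) • w) CH δ)
    (hδ : 0 ≤ δ) {c B : ℝ} (hB : 0 ≤ B) (hcB : |c| ≤ B) (hc : ¬ Near N w u → c = 0) :
    BiLoc (c • H) u u (B * CH * Real.exp (6 * δ * (((d : ℝ) + 1) * N)) * Real.exp (-δ * l1 (u - (N : ℤ) • w))) δ := by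
  have hCH : 0 ≤ CH := hH.nonneg (Sum.inl 0)
  by_cases hn : Near N w u
  · -- `u` in the box of `w`: `|u − N•w|₁ ≤ 2(d+1)N`; re-centre both legs and absorb
    have hl : l1 (u - (N : ℤ) • w) ≤ 2 * ((d : ℝ) + 1) * N := l1_le_of_near hn (near_self hN w)
    have h1 := biLoc_recentre hH hδ u u
    have h2 := biLoc_smul h1 c
    refine biLoc_weaken h2 ?_ le_rfl
    rw [l1_sub_symm ((N : ℤ) • w) u]
    have e3 : Real.exp (6 * δ * (((d : ℝ) + 1) * N)) * Real.exp (-δ * l1 (u - (N : ℤ) • w)) ≥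
        Real.exp (δ * (l1 (u - (N : ℤ) • w) + l1 (u - (N : ℤ) • w))) := by
      rw [← Real.exp_add]
      exact Real.exp_le_exp.2 (by nlinarith)
    calc |c| * (CH * Real.exp (δ * (l1 (u - (N : ℤ) • w) + l1 (u - (N : ℤ) • w))))
        ≤ B * (CH * Real.exp (δ * (l1 (u - (N : ℤ) • w) + l1 (u - (N : ℤ) • w)))) := mul_le_mul_of_nonneg_right hcB (by positivity)
      _ ≤ B * (CH * (Real.exp (6 * δ * (((d : ℝ) + 1) * N)) * Real.exp (-δ * l1 (u - (N : ℤ) • w)))) :=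
          mul_le_mul_of_nonneg_left (mul_le_mul_of_nonneg_left e3 hCH) hB
      _ = _ := by ring
  · -- off the box the scalar vanishes
    rw [hc hn, zero_smul]
    intro x z a b
    simp only [Pi.zero_apply, abs_zero]
    positivity

/-! ## §2 `symRMrAn1` is a `LocStencilFM` family -/

section Literal

variable {Lc : ℕ} [NeZero Lc]

open Classical in
/-- [folklore] **an1's MIXED REFLECTION REMAINDER IS A `LocStencilFM` FAMILY**: for every `cΛ`, `γ`, level `j` and axis `α`,
`∃ C δ, 0 < δ ∧ LocStencilFM Lc (symRMrAn1 Lc cΛ γ j α) C δ` — the three displayed words of `symRMrAn1` are each bi-localised at the fine bond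
`u` with a constant decaying in `|u − Lc•w|₁`: the product `diagK (ctGen κ u) ∘ H ρ w` and the commutator `conjV (M1 ρ w) (diagK (γ_j·E_{κu}))` by
an2's far-product lemmas, the scalar word by §1 with `symLinKerAt_eq_zero` ∕ `abs_symLinKerAt_le`.  No `Odd Lc`, no lock, no letter. -/
theorem locStencilFM_symRMrAn1 (cΛ : ℝ) (γ : ℕ → ℝ) (j : ℕ) (α : Fin 4) :
    ∃ C δ : ℝ, 0 < δ ∧ LocStencilFM Lc (symRMrAn1 Lc cΛ γ j α) C δ := by
  have hL1 : 1 ≤ Lc := one_le_of_neZero Lc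
  have hr := ctrOff_mem_box (d := 4) hL1
  -- the border-reading generator's rate
  obtain ⟨δB, CB, hδB, hCB, hBd⟩ := pkg_of_spr (spr_add (spr_bhK (d := 3) hL1) (spr_Dsh hL1))
  set m : ℝ := δB / 2 with hm_def
  have hm : 0 < m := by positivity
  -- the letters at the common rate `m`
  have hH := vertexFamily_symHessFFAt (d := 3) hL1 hr hm.le
  have hM1 := vertexFamily_M1Of hH cΛ j
  have hG : ∀ (κ : Fin 4) (u : Fin 4 → ℤ), BiLoc (diagK (ctGen 3 α Lc κ u)) u u (cCT 3 Lc m) m := fun κ u => biLoc_diagK_ctGen α Lc κ u hm.le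
  have hE : LocStencil (fun κ u => diagK fun p a => γ j * ctGenM 3 (bhK Lc + Dsh Lc) α Lc κ u p a) _ m :=
    locStencil_diagK_mul_ctGenM hBd hδB.le (γ j) α Lc
  have hell : 0 ≤ (AveragingHessianKernels.ell (3 + 1) Lc : ℝ) := by positivity
  -- word 1: the comb generator times the Hessian table (far product, rate m/4)
  obtain ⟨K1, h1⟩ : ∃ K1 : ℝ, ∀ (κ : Fin 4) (u : Fin 4 → ℤ) (ρ : Fin 4) (w : Fin 4 → ℤ),
      BiLoc (comp (diagK (ctGen 3 α Lc κ u)) (symHessFFAt (ctr 4 Lc) Lc ρ w)) u u (K1 * Real.exp (-(m / 4) * l1 (u - (Lc : ℤ) • w))) (m / 4) :=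
    ⟨_, fun κ u ρ w => by
      have h := biLoc_comp_far_right (hG κ u) (hH ρ w) hm
      rwa [l1_sub_symm ((Lc : ℤ) • w) u] at h⟩
  -- word 2: the box-supported scalar times the Hessian table (rate m, lowered to m/4)
  obtain ⟨K2, h2⟩ : ∃ K2 : ℝ, ∀ (κ : Fin 4) (u : Fin 4 → ℤ) (ρ : Fin 4) (w : Fin 4 → ℤ),
      BiLoc ((2 * (if ρ = α then symLinKerAt (ctr 4 Lc) Lc ρ w (κ, u) else 0)) • symHessFFAt (ctr 4 Lc) Lc ρ w) u u
        (K2 * Real.exp (-(m / 4) * l1 (u - (Lc : ℤ) • w))) (m / 4) :=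
    ⟨_, fun κ u ρ w => by
      have hCH0 := (hH ρ w).nonneg (Sum.inl 0)
      refine biLoc_smul_near (d := 3) hL1 (biLoc_mono (hH ρ w) hCH0 (by linarith)) (by positivity)
        (B := 2 * (AveragingHessianKernels.ell (3 + 1) Lc : ℝ)) (by positivity) ?_ ?_
      · rw [abs_mul, abs_two]
        refine mul_le_mul_of_nonneg_left ?_ (by norm_num)
        split_ifs
        · exact abs_symLinKerAt_le (d := 3 + 1) hL1 ρ w hr (κ, u)
        · rw [abs_zero]; exact hell
      · intro hn
        have : symLinKerAt (ctr 4 Lc) Lc ρ w (κ, u) = 0 := symLinKerAt_eq_zero (d := 3 + 1) hr hn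
        simp [this]⟩
  -- word 3: the commutator of the multiplier table with the border-reading generator (two far products)
  obtain ⟨K3, h3a⟩ : ∃ K3 : ℝ, ∀ (κ : Fin 4) (u : Fin 4 → ℤ) (ρ : Fin 4) (w : Fin 4 → ℤ),
      BiLoc (comp (M1Of 3 Lc (symHessFFAt (ctr 4 Lc) Lc) cΛ j ρ w) (diagK fun p a => γ j * ctGenM 3 (bhK Lc + Dsh Lc) α Lc κ u p a)) u u
        (K3 * Real.exp (-(m / 4) * l1 (u - (Lc : ℤ) • w))) (m / 4) :=
    ⟨_, fun κ u ρ w => by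
      have h := biLoc_comp_far_left (hM1 ρ w) (hE κ u) hm
      rwa [l1_sub_symm ((Lc : ℤ) • w) u] at h⟩
  obtain ⟨K4, h3b⟩ : ∃ K4 : ℝ, ∀ (κ : Fin 4) (u : Fin 4 → ℤ) (ρ : Fin 4) (w : Fin 4 → ℤ),
      BiLoc (comp (diagK fun p a => γ j * ctGenM 3 (bhK Lc + Dsh Lc) α Lc κ u p a) (M1Of 3 Lc (symHessFFAt (ctr 4 Lc) Lc) cΛ j ρ w)) u u
        (K4 * Real.exp (-(m / 4) * l1 (u - (Lc : ℤ) • w))) (m / 4) :=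
    ⟨_, fun κ u ρ w => by
      have h := biLoc_comp_far_right (hE κ u) (hM1 ρ w) hm
      rwa [l1_sub_symm ((Lc : ℤ) • w) u] at h⟩
  -- assemble, word by word, with the common exponential factor
  refine ⟨|wM2 3 Lc j| * (|(2 : ℝ)| * K1 + K2) + (K3 + K4), m / 4, by positivity, fun κ u ρ w => ?_⟩
  have h1' : BiLoc ((2 : ℝ) • comp (diagK (ctGen 3 α Lc κ u)) (symHessFFAt (ctr 4 Lc) Lc ρ w)) u u
      ((|(2 : ℝ)| * K1) * Real.exp (-(m / 4) * l1 (u - (Lc : ℤ) • w))) (m / 4) := by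
    have h := biLoc_smul (h1 κ u ρ w) (2 : ℝ)
    rwa [← mul_assoc] at h
  have h12 := biLoc_add' h1' (h2 κ u ρ w)
  have h12' : BiLoc (wM2 3 Lc j • ((2 : ℝ) • comp (diagK (ctGen 3 α Lc κ u)) (symHessFFAt (ctr 4 Lc) Lc ρ w)
        + (2 * (if ρ = α then symLinKerAt (ctr 4 Lc) Lc ρ w (κ, u) else 0)) • symHessFFAt (ctr 4 Lc) Lc ρ w)) u u
      ((|wM2 3 Lc j| * (|(2 : ℝ)| * K1 + K2)) * Real.exp (-(m / 4) * l1 (u - (Lc : ℤ) • w))) (m / 4) := by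
    have h := biLoc_smul h12 (wM2 3 Lc j)
    rwa [← mul_assoc] at h
  have h3 := biLoc_sub' (h3a κ u ρ w) (h3b κ u ρ w)
  have h := biLoc_sub' h12' h3
  -- `symRMrAn1` unfolded
  have e : symRMrAn1 Lc cΛ γ j α κ u ρ w =
      wM2 3 Lc j • ((2 : ℝ) • comp (diagK (ctGen 3 α Lc κ u)) (symHessFFAt (ctr 4 Lc) Lc ρ w)
        + (2 * (if ρ = α then symLinKerAt (ctr 4 Lc) Lc ρ w (κ, u) else 0)) • symHessFFAt (ctr 4 Lc) Lc ρ w)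
      - conjV (M1Of 3 Lc (symHessFFAt (ctr 4 Lc) Lc) cΛ j ρ w) (diagK fun p c => γ j * ctGenM 3 (bhK Lc + Dsh Lc) α Lc κ u p c) := rfl
  rw [e]
  unfold ChartConjugation.conjV
  exact h

end Literal

end Summit.QuantumFields.BalabanUV.Beta.SymMixedRemainderClass

end
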